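import Summits.Ventures.LatticeQCDFlow.Scaling.DominatedStarRegimeFreeCost

/-!
HONEST FRAMING: exact (Metropolis-corrected) sampling algorithms for lattice gauge theory; figures
of merit are autocorrelation/cost numbers at stated couplings and volumes; no continuum-physics
claim.

# DoeblinHotRegimeFree — A DOEBLIN-MINORISED HOT SAMPLER (`M_0(u,·) ≥ a·μ_0`, E.G. INDEPENDENCE METROPOLIS FROM A FLOW WITH
# IMPORTANCE WEIGHTS WITHIN A FACTOR `1/a`) HAS POINCARÉ CONSTANT `≥ a`, SO THE MAP-ASSISTED HUB IT DRIVES OBEYS, WITH NO REGIME,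
# `Gap ≥ p·min{ct/(3m), a(1−t)w_0/(7K)}` AND `τ_int(g) ≤ 1/(p·min{…}) − ½`; AT `t = 1/2`, `w_0 = 1`, `m ≤ cK`:
# `τ_int(g) ≤ 14K/(pa) − ½` AND AT MOST `7K(κ_s + κ_u)/(pa)` PER AUTOCORRELATION TIME — LINEAR IN `1/p` AND IN `1/a`
# (lean-2 GEN-28, ours)

Venture-side (OURS).  Cell `lqcd-flow` (pub-lqcd), unit `pub-lqcd-lean-2-g28`, 2026-08-28.  Chapter N, file 6: the realistic hot
level.  The D-line of GEN-27 (`Scaling/DoeblinHotSampler` … `Scaling/DoeblinHotTimeAverages`) carried every chapter-M ceiling to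
hot kernels `M_0 = a·Ẽ + (1−a)·R` with `w_0 ↦ a·w_0` — inside the regime `4t ≤ p(1−t)·a·w_0`, which shrinks with `a`.  For the
quadratic theory no decomposition and no regime is needed: the minorisation `M_0(u,v) ≥ a·μ_0(v)` alone gives
`𝓔_{μ_0}(M_0; h) ≥ a·Var_{μ_0}(h)`, i.e. the hot Poincaré constant `γ₀ ≥ a` that `Scaling/DominatedStarRegimeFreeGap` (N2) and
`Scaling/DominatedStarRegimeFreeAutocorrelation` (N3) take as input.

## What is proved

* §1 **`doeblin_poincare`** — `M_0(u,v) ≥ a·μ_0(v)` for all `u, v` ⇒ `a·Var_{μ_0}(h) ≤ 𝓔_{μ_0}(M_0; h)` for every `h`;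
  `doeblin_isIrreducible` (`a > 0`, `μ_0 > 0`).
* §2 **`doeblinEntryStar_spectralGap_ge`** — `Gap ≥ p·min{ct/(3m), a(1−t)w_0/(7K)}` (hot kernel `μ_0`-reversible with the
  minorisation, cold kernels `μ_k`-reversible, one-sided transported domination, multiplicities `≥ c ≥ 1`, `0 < t < 1`, `w_0 > 0`);
  **`doeblinEntryStar_tauInt_le`** — `τ_int(g) ≤ 1/(p·min{ct/(3m), a(1−t)w_0/(7K)}) − ½`;
  **`doeblinEntryStar_tauInt_le_half`** — `t = 1/2`, `w_0 = 1`, `m ≤ cK`: `τ_int(g) ≤ 14K/(pa) − ½`;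
  **`doeblinHalfStar_autocorrelationCost_le`** — same: `τ_int(g)·((κ_s + κ_u)/2) ≤ 7K(κ_s + κ_u)/(pa)`.

Reading (no numerics implied): a trained flow used as an independence proposal at the hot level with importance weights bounded
within a factor `1/a`, plus transports of one-sided quality `p` to the cold levels, decorrelates every observable of the exact
(Metropolis-corrected) hub within order `K/(pa)` steps at uniform listing and half swaps — the flow's two quality parameters enter as a
product, each linearly, with no tuning condition between the swap fraction and either of them.  NOT CLAIMED: the absolute gap and
a mixing time for Doeblin hot kernels without the regime (the exact-draw projection argument of N4 needs the residual kernel's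
Dirichlet form; not typed here); anything with `log K`; anything measured.  Literature grade (cell rule): OWN COMPOSITION on N2/N3/N5;
nothing cited as a fact; no new bib keys.
-/

noncomputable section

open Finset Function
open Literature.Probability.MarkovChains

namespace Summit.Ventures.LatticeQCDFlow.Scaling

variable {S : Type*} [Fintype S] [DecidableEq S] {K m : ℕ} {μ : Fin (K + 1) → S → ℝ} {M : Fin (K + 1) → S → S → ℝ}
  {w : Fin (K + 1) → ℝ} {t p a : ℝ}

/-! ## §1 A Doeblin minorisation is a Poincaré inequality -/

omit [DecidableEq S] in
/-- **`M_0(u,v) ≥ a·μ_0(v)` ⇒ `a·Var_{μ_0}(h) ≤ 𝓔_{μ_0}(M_0; h)`** (`μ_0 ≥ 0` a probability vector). [ours] -/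
theorem doeblin_poincare [DecidableEq S] (hμ0 : ∀ u, 0 ≤ μ 0 u) (hμ1 : ∑ u, μ 0 u = 1) (hmin : ∀ u v, a * μ 0 v ≤ M 0 u v)
    (h : S → ℝ) : a * lawVariance (μ 0) h ≤ dirichletForm (μ 0) (M 0) h := by
  rw [lawVariance_eq_half_sum hμ1]
  unfold dirichletForm
  rw [← mul_assoc, mul_comm a (1 / 2), mul_assoc, mul_sum]
  refine mul_le_mul_of_nonneg_left (sum_le_sum fun u _ => ?_) (by norm_num)
  rw [mul_sum]
  refine sum_le_sum fun v _ => ?_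
  have h1 : a * μ 0 v * (μ 0 u * (h u - h v) ^ 2) ≤ M 0 u v * (μ 0 u * (h u - h v) ^ 2) :=
    mul_le_mul_of_nonneg_right (hmin u v) (mul_nonneg (hμ0 u) (sq_nonneg _))
  calc a * ((h u - h v) ^ 2 * (μ 0 u * μ 0 v)) = a * μ 0 v * (μ 0 u * (h u - h v) ^ 2) := by ring
    _ ≤ M 0 u v * (μ 0 u * (h u - h v) ^ 2) := h1
    _ = μ 0 u * M 0 u v * (h u - h v) ^ 2 := by ring

omit [DecidableEq S] in
/-- A Doeblin-minorised kernel over a positive law is irreducible (one step; `a > 0`). [ours] -/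
theorem doeblin_isIrreducible [DecidableEq S] (hμ : ∀ u, 0 < μ 0 u) (ha : 0 < a) (hmin : ∀ u v, a * μ 0 v ≤ M 0 u v) :
    Literature.Probability.MarkovChains.IsIrreducible (M 0) :=
  fun u v => ⟨1, by rw [pow_one]; exact lt_of_lt_of_le (mul_pos ha (hμ v)) (hmin u v)⟩

section EntryStar
variable (κ : Fin m → Fin K) (φ : Fin m → Equiv.Perm S)

/-! ## §2 The map-assisted hub driven by a Doeblin hot sampler, without the regime -/

/-- **`Gap ≥ p·min{ct/(3m), a(1−t)w_0/(7K)}` FOR A DOEBLIN HOT SAMPLER, NO REGIME** (`M_0(u,·) ≥ a·μ_0`, `0 < a`; hot kernel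
`μ_0`-reversible, cold kernels `μ_k`-reversible; one-sided transported domination `p·μ_{κ_r+1}(φ_r u) ≤ μ_0(u)`, `0 < p ≤ 1`; hub
multiplicities `≥ c ≥ 1`; `0 < t < 1`, `w ≥ 0`, `Σw = 1`, `w_0 > 0`; `|S| ≥ 2`, `K ≥ 1`). [ours] -/
theorem doeblinEntryStar_spectralGap_ge [Nontrivial S] (hK : 1 ≤ K) (hm : 1 ≤ m) (hμ : ∀ k x, 0 < μ k x)
    (hμ1 : ∀ k, ∑ u, μ k u = 1) (hM : ∀ k, IsRowStochastic (M k)) (hMrev : ∀ k, DetailedBalance (μ k) (M k))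
    (hw0 : ∀ k, 0 ≤ w k) (hw1 : ∑ k, w k = 1) (hwhot : 0 < w 0) (ht0 : 0 < t) (ht1 : t < 1) (hp : 0 < p) (hp1 : p ≤ 1)
    (ha : 0 < a) (hmin : ∀ u v, a * μ 0 v ≤ M 0 u v) (hdom : ∀ (r : Fin m) (u : S), p * μ (κ r).succ (φ r u) ≤ μ 0 u)
    {c : ℕ} (hc1 : 1 ≤ c) (hc : ∀ k : Fin K, c ≤ (univ.filter (fun r : Fin m => κ r = k)).card) :
    p * min (c * t / (3 * m)) (a * (1 - t) * w 0 / (7 * K))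
      ≤ spectralGap (tensorFun μ) (fun y z : Fin (K + 1) → S =>
          t * ptGraphSwap μ (fun r : Fin m => (((0 : Fin (K + 1)), (κ r).succ) : Fin (K + 1) × Fin (K + 1))) φ y z
            + (1 - t) * prodKernel w M y z) :=
  entryStar_spectralGap_ge κ φ hK hm hμ hμ1 hM hMrev hw0 hw1 hwhot ht0 ht1 hp hp1 ha hdom
    (doeblin_poincare (fun u => (hμ 0 u).le) (hμ1 0) hmin) hc1 hc

/-- **`τ_int(g) ≤ 1/(p·min{ct/(3m), a(1−t)w_0/(7K)}) − ½` FOR EVERY OBSERVABLE, DOEBLIN HOT SAMPLER, NO REGIME** (`Var(g) > 0`).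
[ours] -/
theorem doeblinEntryStar_tauInt_le [Nontrivial S] (hK : 1 ≤ K) (hm : 1 ≤ m) (hμ : ∀ k x, 0 < μ k x)
    (hμ1 : ∀ k, ∑ u, μ k u = 1) (hM : ∀ k, IsRowStochastic (M k)) (hMrev : ∀ k, DetailedBalance (μ k) (M k))
    (hw0 : ∀ k, 0 ≤ w k) (hw1 : ∑ k, w k = 1) (hwhot : 0 < w 0) (ht0 : 0 < t) (ht1 : t < 1) (hp : 0 < p) (hp1 : p ≤ 1)
    (ha : 0 < a) (hmin : ∀ u v, a * μ 0 v ≤ M 0 u v) (hdom : ∀ (r : Fin m) (u : S), p * μ (κ r).succ (φ r u) ≤ μ 0 u)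
    {c : ℕ} (hc1 : 1 ≤ c) (hc : ∀ k : Fin K, c ≤ (univ.filter (fun r : Fin m => κ r = k)).card)
    {g : (Fin (K + 1) → S) → ℝ} (hg : 0 < lawVariance (tensorFun μ) g) :
    asympVar g (tensorFun μ) (fun y z : Fin (K + 1) → S =>
        t * ptGraphSwap μ (fun r : Fin m => (((0 : Fin (K + 1)), (κ r).succ) : Fin (K + 1) × Fin (K + 1))) φ y z
          + (1 - t) * prodKernel w M y z) / (2 * lawVariance (tensorFun μ) g)
      ≤ 1 / (p * min (c * t / (3 * m)) (a * (1 - t) * w 0 / (7 * K))) - 1 / 2 :=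
  entryStar_tauInt_le κ φ hK hm hμ hμ1 hM hMrev (doeblin_isIrreducible (hμ 0) ha hmin) hw0 hw1 hwhot ht0 ht1 hp hp1 ha hdom
    (doeblin_poincare (fun u => (hμ 0 u).le) (hμ1 0) hmin) hc1 hc hg

/-- **`t = 1/2`, `w_0 = 1`, `m ≤ cK`: `τ_int(g) ≤ 14K/(pa) − ½` FOR EVERY OBSERVABLE** (Doeblin hot sampler with `0 < a ≤ 1`). [ours] -/
theorem doeblinEntryStar_tauInt_le_half [Nontrivial S] (hK : 1 ≤ K) (hm : 1 ≤ m) (hμ : ∀ k x, 0 < μ k x)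
    (hμ1 : ∀ k, ∑ u, μ k u = 1) (hM : ∀ k, IsRowStochastic (M k)) (hMrev : ∀ k, DetailedBalance (μ k) (M k))
    (hw0 : ∀ k, 0 ≤ w k) (hw01 : w 0 = 1) (hw1 : ∑ k, w k = 1) (hp : 0 < p) (hp1 : p ≤ 1) (ha : 0 < a) (ha1 : a ≤ 1)
    (hmin : ∀ u v, a * μ 0 v ≤ M 0 u v) (hdom : ∀ (r : Fin m) (u : S), p * μ (κ r).succ (φ r u) ≤ μ 0 u)
    {c : ℕ} (hc1 : 1 ≤ c) (hc : ∀ k : Fin K, c ≤ (univ.filter (fun r : Fin m => κ r = k)).card) (hmcK : (m : ℝ) ≤ c * K)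
    {g : (Fin (K + 1) → S) → ℝ} (hg : 0 < lawVariance (tensorFun μ) g) :
    asympVar g (tensorFun μ) (fun y z : Fin (K + 1) → S =>
        (1 / 2 : ℝ) * ptGraphSwap μ (fun r : Fin m => (((0 : Fin (K + 1)), (κ r).succ) : Fin (K + 1) × Fin (K + 1))) φ y z
          + (1 - 1 / 2) * prodKernel w M y z) / (2 * lawVariance (tensorFun μ) g)
      ≤ 14 * K / (p * a) - 1 / 2 := by
  have hKpos : (0 : ℝ) < K := Nat.cast_pos.mpr (by omega)
  have hmpos : (0 : ℝ) < m := Nat.cast_pos.mpr (by omega)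
  have hcpos : (0 : ℝ) < c := Nat.cast_pos.mpr (by omega)
  have h := doeblinEntryStar_tauInt_le κ φ hK hm hμ hμ1 hM hMrev hw0 hw1 (by rw [hw01]; exact one_pos) (t := 1 / 2)
    (by norm_num) (by norm_num) hp hp1 ha hmin hdom hc1 hc hg
  rw [hw01] at h
  -- the floor is at least `pa/(14K)`: `c·(1/2)/(3m) ≥ 1/(6K) ≥ a/(14K)` and `a(1−1/2)·1/(7K) = a/(14K)`
  have hmin' : a / (14 * (K : ℝ)) ≤ min (c * (1 / 2) / (3 * (m : ℝ))) (a * (1 - 1 / 2) * 1 / (7 * K)) := by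
    refine le_min ?_ (le_of_eq (by ring))
    rw [div_le_div_iff₀ (by positivity) (by positivity)]
    nlinarith [mul_le_mul hmcK ha1 ha.le (by positivity : (0 : ℝ) ≤ c * K)]
  have hpos : 0 < p * (a / (14 * (K : ℝ))) := by positivity
  have hle : 1 / (p * min (c * (1 / 2) / (3 * (m : ℝ))) (a * (1 - 1 / 2) * 1 / (7 * K))) ≤ 1 / (p * (a / (14 * K))) :=
    one_div_le_one_div_of_le hpos (mul_le_mul_of_nonneg_left hmin' hp.le)
  have e : 1 / (p * (a / (14 * (K : ℝ)))) = 14 * K / (p * a) := by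
    field_simp
  linarith [h, hle, e.le, e.ge]

/-- **`t = 1/2`, `w_0 = 1`, `m ≤ cK`: AT MOST `7K(κ_s + κ_u)/(pa)` PER AUTOCORRELATION TIME OF ANY OBSERVABLE** (swap attempt
`κ_s ≥ 0`, update `κ_u ≥ 0`; Doeblin hot sampler `0 < a ≤ 1`). [ours] -/
theorem doeblinHalfStar_autocorrelationCost_le [Nontrivial S] (hK : 1 ≤ K) (hm : 1 ≤ m) (hμ : ∀ k x, 0 < μ k x)
    (hμ1 : ∀ k, ∑ u, μ k u = 1) (hM : ∀ k, IsRowStochastic (M k)) (hMrev : ∀ k, DetailedBalance (μ k) (M k))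
    (hw0 : ∀ k, 0 ≤ w k) (hw01 : w 0 = 1) (hw1 : ∑ k, w k = 1) (hp : 0 < p) (hp1 : p ≤ 1) (ha : 0 < a) (ha1 : a ≤ 1)
    (hmin : ∀ u v, a * μ 0 v ≤ M 0 u v) (hdom : ∀ (r : Fin m) (u : S), p * μ (κ r).succ (φ r u) ≤ μ 0 u)
    {c : ℕ} (hc1 : 1 ≤ c) (hc : ∀ k : Fin K, c ≤ (univ.filter (fun r : Fin m => κ r = k)).card) (hmcK : (m : ℝ) ≤ c * K)
    {κs κu : ℝ} (hκs : 0 ≤ κs) (hκu : 0 ≤ κu) {g : (Fin (K + 1) → S) → ℝ} (hg : 0 < lawVariance (tensorFun μ) g) :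
    asympVar g (tensorFun μ) (fun y z : Fin (K + 1) → S =>
        (1 / 2 : ℝ) * ptGraphSwap μ (fun r : Fin m => (((0 : Fin (K + 1)), (κ r).succ) : Fin (K + 1) × Fin (K + 1))) φ y z
          + (1 - 1 / 2) * prodKernel w M y z) / (2 * lawVariance (tensorFun μ) g) * ((κs + κu) / 2)
      ≤ 7 * K * (κs + κu) / (p * a) := by
  have hKpos : (0 : ℝ) < K := Nat.cast_pos.mpr (by omega)
  have hτ := doeblinEntryStar_tauInt_le_half κ φ hK hm hμ hμ1 hM hMrev hw0 hw01 hw1 hp hp1 ha ha1 hmin hdom hc1 hc hmcK hg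
  have hcost : 0 ≤ (κs + κu) / 2 := by positivity
  have h := mul_le_mul_of_nonneg_right hτ hcost
  refine h.trans ?_
  have e : 14 * (K : ℝ) / (p * a) * ((κs + κu) / 2) = 7 * K * (κs + κu) / (p * a) := by
    field_simp
    ring
  have hsum : 0 ≤ κs + κu := by positivity
  nlinarith [e]

end EntryStar

end Summit.Ventures.LatticeQCDFlow.Scaling

end
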